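import Summits.BirchSwinnertonDyer.BirchSwinnertonDyer.Theorems.EisensteinDepletionAtTwoStarSplitGlue
import HarnessLib

/-!
# E1M ⇐ (★-GO₂^Σ) ∧ (★-OptB): the star split of `DepletedLambdaLawAtTwoMod` needs generalized Ogg at 2 only MODULO THE SHIMURA SUBGROUP

Helper for the crux E1M `DepletedLambdaLawAtTwoMod` (stmt-BirchSwinnertonDyer-20341) of route `EisensteinDepletionAtTwo`
(planner bsd-rank2-p2 GEN 29).  The gen-1 split of E1M is `StarGO2 → StarOptB → DepletedLambdaLawAtTwoMod`
(`Theorems/EisensteinDepletionAtTwoStarSplitGlue.lean`, item 24446).  Its child `StarGO2` (item 24444, «generalized Ogg at the prime 2,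
étale form»: the discrepancy `t := φ₀^*(Q) − c_β ∈ J₀(N)[2]` VANISHES for some admissible `β`) is stronger than what the glue consumes:
the only consumer of the global symbol law is (★-SymbC, all levels), i.e. `sameOnC_of_globalCongruence` + `depthZero_of_globalCongruence`,
and both use the law only on the two cusps `a/2^m`, `1/2^m` of a C-pair, WHICH HAVE THE SAME DENOMINATOR `d = 2^m`.  Hence any
correction of the parity law by a function of `d` alone cancels, and E1M follows verbatim from the WEAKER child

* `StarGO2Sigma` (★-GO₂^Σ): same binders as `StarGO2`; for SOME admissible `β`, some scale `g' ≠ 0` and some `e : ℤ → ℤ`,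
  `Φ_β(b,d) = n'g'` on every cusp `b/d` (`d > 0`, `gcd(d, bN_W) = 1`) with «`n'` even ⟺ (the loop `{0,b/d}` pairs evenly with `λ/2`
  ⟺ `e d` even)», and `Φ_β/g'` is ODD at some such cusp (primitivity of the Eisenstein scale — in the untwisted glue this came for
  free from the curve side through the congruence; with a twist it has to be asked, and it is what generalized-Ogg-mod-Σ delivers:
  the primitive 2-power root of the η-quotient).

MEANING.  (★-GO₂^Σ) says that the Kummer functional of `t` factors through `γ ↦ d_γ`; this holds as soon as `t ∈ Σ_N[2]`, the
2-torsion of the Shimura subgroup `Σ_N = ker(J₀(N) → J₁(N))` (Ling–Oesterlé): the functional of `s_ε` is `γ ↦ ε(d_γ)`, take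
`e d := (1 − ε d)/2`.  So (★-GO₂^Σ) ⇐ «`t` is formal at 2» (Serre-dlog, every admissible `β`) + «a ℚ-rational 2-torsion point of
`J₀(N)` formal at 2 lies in `Σ_N`» (THEOREM A of the cell memo p2/g29/THEOREM-A-v2.md, from the unbounded-denominators theorem of
Calegari–Dimitrov–Tang on the smooth model `X_μ(N)`), with NO component-group / «Shimura-discrepancy removal» input — those serve
only to upgrade `t ∈ Σ_N[2]` to `t = 0`.

CONTENT OF THIS FILE (sorry-free; nothing here proves `StarGO2Sigma`, `StarOptB`, E1M or BSD):
* `StarGO2Sigma` — the statement (a `def … : Prop`, candidate replacement child of the split; census: a fortiori that of `StarGO2`);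
* `sameOnC_of_twistedCongruence`, `depthZero_of_twistedCongruence` — the two bookkeeping steps with the twist carried along;
* `starSymbCAll_of_starOptB_starGO2Sigma` — (★-SymbC, all levels) from `StarOptB` ∧ `StarGO2Sigma` (port of
  `starSymbCAll_of_starOptB_starGO2`, same statement);
* `depletedLambdaLawAtTwoMod_of_starGO2Sigma : StarGO2Sigma → StarOptB → DepletedLambdaLawAtTwoMod` — modus ponens through the
  tree theorems `star_glueFin`, `starEisEight₂`, `starEisFin`, `starCongruence_of_starCore`, `depletedLambdaLawAtTwoMod_of_starCongruence`,
  exactly as `depletedLambdaLawAtTwoModOfStar_proof`;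
* `starGO2Sigma_of_starGO2_of_oddWitness` — the untwisted child with an odd Eisenstein witness implies the twisted one (`e := 0`).

References: V. Vatsal, *Multiplicative subgroups of J₀(N) and applications to elliptic curves*, J. Inst. Math. Jussieu 4 (2005)
§1.5 [Vatsal2005]; S. Ling, J. Oesterlé, *The Shimura subgroup of J₀(N)*, Astérisque 196–197 (1991) [LingOesterle1991];
F. Calegari, V. Dimitrov, Y. Tang, *The unbounded denominators conjecture*, J. Amer. Math. Soc. 38 (2025), Thm. 1.0.1
[CalegariDimitrovTang2021]; B. Mazur, J. Tate, J. Teitelbaum, Invent. Math. 84 (1986) §I.10–I.13 [MazurTateTeitelbaum1986Invent].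
-/

set_option linter.dupNamespace false
set_option autoImplicit false

noncomputable section

open _root_.WeierstrassCurve
open Literature.NumberTheory.EllipticCurves
open Literature.NumberTheory.EllipticCurves.Greenberg1999
open Literature.NumberTheory.EllipticCurves.ModularForms
open Literature.NumberTheory.Automorphic
open Summit.BirchSwinnertonDyer.BirchSwinnertonDyer.Theses.EisensteinDepletionAtTwo
open scoped MatrixGroups

namespace Summit.BirchSwinnertonDyer.BirchSwinnertonDyer.Theorems

namespace DepletionAtTwo

/-- **(★-GO₂^Σ)** — generalized Ogg AT THE PRIME 2 for ÉTALE rational `2`-torsion of optimal curves, MODULO THE SHIMURA SUBGROUP,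
functional form.  For the optimal model `(W₀, L₀, q)` of the class of `f` (carrier `W` good ordinary at `2`), a rational `2`-torsion
point `x₀` of `W₀` NOT ramified at `2` with half-lattice vector `λ`, and admissible data existing at `N_W`: for SOME admissible `β`,
some scale `g' ≠ 0` and some `e : ℤ → ℤ`, the stabilised Eisenstein period is `Φ_β(b,d) = n'g'` on every cusp `b/d` (`d > 0`,
`gcd(d, bN_W) = 1`) with «`n'` even ⟺ (`q·{0,b/d}_f ∈ ℤλ + 2Λ₀` ⟺ `e d` even)», and `Φ_β/g'` is odd at some such cusp.
The binders are those of the route item `StarGO2` verbatim; only the conclusion is weakened (twist `e`) and completed by the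
Eisenstein odd witness.  (A problem-side statement — candidate route item — not a literature fact: no cite tag on purpose;
background Vatsal 2005 §1.5, Mazur–Tate–Teitelbaum 1986 §I.10.) -/
def StarGO2Sigma : Prop :=
  ∀ (W : WeierstrassCurve ℚ) [W.IsElliptic] [W.IsGloballyMinimal] (W₀ : WeierstrassCurve ℚ) [W₀.IsElliptic] [W₀.IsGloballyMinimal]
    ⦃N : ℕ⦄ [NeZero N] (f : CuspForm (CongruenceSubgroup.Gamma0 N) 2), IsNewformOf W f → IsNewformOf W₀ f → IsOrdinaryAt W 2 →
    ∀ (L₀ : PeriodPair), IsNeronLatticeOf (W₀.baseChange ℂ) L₀ → ∀ (q : ℚ), q ≠ 0 →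
      (∀ z ∈ periodLattice f, (q : ℂ) * z ∈ L₀.lattice) → (∀ z ∈ L₀.lattice, ∃ w ∈ periodLattice f, z = (q : ℂ) * w) →
    ∀ (x₀ : ℚ), HasRationalTwoTorsionX W₀ x₀ → ¬ TwoTorsionRamifiedAtTwo x₀ →
    ∀ (lam : ℂ), lam ∈ L₀.lattice → lam / 2 ∉ L₀.lattice → L₀.weierstrassP (lam / 2) - ((W₀.b₂ : ℚ) : ℂ) / 12 = ((x₀ : ℚ) : ℂ) →
      (∃ β : ℕ → ℕ, IsAdmissibleStabData (W.conductorNorm ℤ) β) →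
      ∃ β : ℕ → ℕ, IsAdmissibleStabData (W.conductorNorm ℤ) β ∧ ∃ g' : ℚ, g' ≠ 0 ∧ ∃ e : ℤ → ℤ,
        (∀ b d : ℤ, 0 < d → Int.gcd d (b * (W.conductorNorm ℤ : ℕ)) = 1 →
          ∃ n' : ℤ, stabEisensteinPeriod (W.conductorNorm ℤ) β (Int.gcdA d (b * (W.conductorNorm ℤ : ℕ))) b
              (-((W.conductorNorm ℤ : ℕ) : ℤ) * Int.gcdB d (b * (W.conductorNorm ℤ : ℕ))) d = n' * g' ∧
            (Even n' ↔ ((∃ k : ℤ, ∃ w ∈ L₀.lattice,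
              (q : ℂ) * (modularSymbol f ((b : ℚ) / (d : ℚ)) - modularSymbol f 0) = (k : ℂ) * lam + 2 * w) ↔ Even (e d)))) ∧
        (∃ b d : ℤ, 0 < d ∧ Int.gcd d (b * (W.conductorNorm ℤ : ℕ)) = 1 ∧
          ∃ n' : ℤ, stabEisensteinPeriod (W.conductorNorm ℤ) β (Int.gcdA d (b * (W.conductorNorm ℤ : ℕ))) b
              (-((W.conductorNorm ℤ : ℕ) : ℤ) * Int.gcdB d (b * (W.conductorNorm ℤ : ℕ))) d = n' * g' ∧ Odd n')

/-- Propositional bookkeeping for the twist: `N ↔ (L ↔ E)` gives `L ↔ (N ↔ E)`. -/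
theorem iff_twist_of_iff_iff {L P E : Prop} (h : P ↔ (L ↔ E)) : L ↔ (P ↔ E) := by tauto

/-- Two twisted parity congruences with the SAME twist `E` give an untwisted congruence of the differences. -/
theorem even_sub_iff_even_sub_of_twist {a a' b b' : ℤ} {E : Prop} (h1 : Even a ↔ (Even a' ↔ E))
    (h2 : Even b ↔ (Even b' ↔ E)) : Even (a - b) ↔ Even (a' - b') := by
  rw [Int.even_sub, Int.even_sub]; tauto

section GlobalToC

variable {N M : ℕ}

/-- **Global^Σ ⇒ C.** As `sameOnC_of_globalCongruence`, but the global congruence between the plus functional (scale `g`) and the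
stabilised Eisenstein functional (scale `g'`) is only asked UP TO A TWIST `e d` DEPENDING ON THE DENOMINATOR; the two cusps `a/2^m`,
`1/2^m` of a C-pair have the same denominator, so the twist cancels in the C-differences.
[cite: MazurTateTeitelbaum1986Invent, §I.10 (10.1)] [cite: Stevens1982, §2.5 (PDF p. 38)] -/
theorem sameOnC_of_twistedCongruence (hM : Odd M) (f : CuspForm (CongruenceSubgroup.Gamma0 N) 2) (β : ℕ → ℕ)
    {g g' : ℚ} (hg : g ≠ 0) (hg' : g' ≠ 0) {e : ℤ → ℤ}
    (hcong : ∀ b d : ℤ, 0 < d → Int.gcd d (b * M) = 1 →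
      ∃ n n' : ℤ, ratPlusSymbol f ((b : ℚ) / (d : ℚ)) - ratPlusSymbol f 0 = n * g ∧
        stabEisensteinPeriod M β (Int.gcdA d (b * M)) b (-(M : ℤ) * Int.gcdB d (b * M)) d = n' * g' ∧
        (Even n ↔ (Even n' ↔ Even (e d))))
    (hdepth : ∃ m a, InC m a ∧ ∃ n : ℤ, plusCuspDiff f m a = n * g ∧ Odd n) :
    ∃ g g' : ℚ, g ≠ 0 ∧ g' ≠ 0 ∧
      (∀ m a, InC m a → ∃ n n' : ℤ, plusCuspDiff f m a = n * g ∧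
        stabEisCuspDiff M β m a = n' * g' ∧ (n : ZMod 2) = (n' : ZMod 2)) ∧
      (∃ m a, InC m a ∧ ∃ n : ℤ, plusCuspDiff f m a = n * g ∧ Odd n) := by
  refine ⟨g, g', hg, hg', fun m a hma ↦ ?_, hdepth⟩
  have ha : Odd a := by
    obtain ⟨-, h4, -, -⟩ := hma
    exact Int.odd_iff.mpr (by omega)
  have hd : (0 : ℤ) < ((2 ^ m : ℕ) : ℤ) := by positivity
  obtain ⟨na, na', h1, h2, h3⟩ := hcong a _ hd (int_gcd_two_pow_eq_one hM ha m)
  obtain ⟨n1, n1', h4, h5, h6⟩ := hcong 1 _ hd (int_gcd_two_pow_eq_one hM odd_one m)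
  refine ⟨na - n1, na' - n1', ?_, ?_, ?_⟩
  · unfold plusCuspDiff
    push_cast at h1 h4 ⊢
    linear_combination h1 - h4
  · rw [stabEisCuspDiff_eq, h2, h5]
    push_cast
    ring
  · have hpar : Even (na' - n1') ↔ Even (na - n1) := (even_sub_iff_even_sub_of_twist h3 h6).symm
    have h2dvd : (2 : ℤ) ∣ (na' - n1') - (na - n1) := even_iff_two_dvd.mp (Int.even_sub.mpr hpar)
    exact (ZMod.intCast_eq_intCast_iff_dvd_sub (na - n1) (na' - n1') 2).mpr (by exact_mod_cast h2dvd)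

/-- **Depth 0 from the twisted global congruence.** If `[b/d]⁺_f − [0]⁺_f ≡ Φ_β(b,d) + e(d)` (mod 2) at scales `(g, g')` on all
cusps `b/d` (`d > 0`, `gcd(d, bM) = 1`), the EISENSTEIN side is ODD at one such cusp, and `‖Φ_β(b,d)‖₂ ≤ 8⁻¹` at every such cusp,
then — because the Eisenstein C-differences have exact 2-content `8` somewhere on `C` (`exists_inC_norm_stabEisCuspDiff_eq`) — the
Eisenstein scale is pinned (`‖g'‖₂ ≤ 8⁻¹`) and some curve-side C-difference `[a/2^m]⁺ − [1/2^m]⁺` is an odd multiple of `g` (the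
twist `e(2^m)` is common to the two cusps of the pair and cancels). [cite: Stevens1982, §5.4 (PDF pp. 73–74)]
[cite: MazurTateTeitelbaum1986Invent, §I.10–I.13] -/
theorem depthZero_of_twistedCongruence (hM : Odd M) (f : CuspForm (CongruenceSubgroup.Gamma0 N) 2) {β : ℕ → ℕ}
    (hadm : IsAdmissibleStabData M β) {g g' : ℚ} {e : ℤ → ℤ}
    (hcong : ∀ b d : ℤ, 0 < d → Int.gcd d (b * M) = 1 →
      ∃ n n' : ℤ, ratPlusSymbol f ((b : ℚ) / (d : ℚ)) - ratPlusSymbol f 0 = n * g ∧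
        stabEisensteinPeriod M β (Int.gcdA d (b * M)) b (-(M : ℤ) * Int.gcdB d (b * M)) d = n' * g' ∧
        (Even n ↔ (Even n' ↔ Even (e d))))
    (heprim : ∃ b d : ℤ, 0 < d ∧ Int.gcd d (b * M) = 1 ∧
      ∃ n' : ℤ, stabEisensteinPeriod M β (Int.gcdA d (b * M)) b (-(M : ℤ) * Int.gcdB d (b * M)) d = n' * g' ∧ Odd n')
    (hE8 : ∀ b d : ℤ, 0 < d → Int.gcd d (b * M) = 1 →
      ‖((stabEisensteinPeriod M β (Int.gcdA d (b * M)) b (-(M : ℤ) * Int.gcdB d (b * M)) d : ℚ) : ℚ_[2])‖ ≤ 8⁻¹) :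
    ∃ m a, InC m a ∧ ∃ n : ℤ, plusCuspDiff f m a = n * g ∧ Odd n := by
  -- (1) the Eisenstein scale: `‖g'‖₂ ≤ 8⁻¹`, from the Eisenstein-side odd witness
  obtain ⟨b₀, d₀, hd₀, hcop₀, n₀', hΦ₀, hn₀'odd⟩ := heprim
  have hg'le : ‖((g' : ℚ) : ℚ_[2])‖ ≤ 8⁻¹ := by
    have h := hE8 b₀ d₀ hd₀ hcop₀
    rw [hΦ₀, Rat.cast_mul, Rat.cast_intCast, norm_mul, norm_intCast_eq_one_of_odd hn₀'odd, one_mul] at h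
    exact h
  -- (2) the odd C-witness of the Eisenstein side pins `n'_a − n'_1` odd
  obtain ⟨m, a, hma, hv⟩ := exists_inC_norm_stabEisCuspDiff_eq hM hadm
  have ha : Odd a := by
    obtain ⟨-, h4, -, -⟩ := hma
    exact Int.odd_iff.mpr (by omega)
  have hd : (0 : ℤ) < ((2 ^ m : ℕ) : ℤ) := by positivity
  obtain ⟨na, na', h1, h2, h3⟩ := hcong a _ hd (int_gcd_two_pow_eq_one hM ha m)
  obtain ⟨n1, n1', h4, h5, h6⟩ := hcong 1 _ hd (int_gcd_two_pow_eq_one hM odd_one m)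
  have hvq : stabEisCuspDiff M β m a = (na' - n1' : ℤ) * g' := by
    rw [stabEisCuspDiff_eq, h2, h5]
    push_cast
    ring
  have hdiff_odd : Odd (na' - n1') := by
    apply odd_of_norm_intCast_eq_one
    apply le_antisymm (Padic.norm_int_le_one _)
    by_contra hlt
    push Not at hlt
    have : ‖((stabEisCuspDiff M β m a : ℚ) : ℚ_[2])‖ < 8⁻¹ := by
      rw [hvq, Rat.cast_mul, Rat.cast_intCast, norm_mul]
      calc ‖((na' - n1' : ℤ) : ℚ_[2])‖ * ‖((g' : ℚ) : ℚ_[2])‖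
          ≤ ‖((na' - n1' : ℤ) : ℚ_[2])‖ * 8⁻¹ := by gcongr
        _ < 1 * 8⁻¹ := by gcongr
        _ = 8⁻¹ := one_mul _
    exact absurd hv this.ne
  -- (3) transfer the parity to the curve side: the twist `e (2^m)` is the same at `a/2^m` and `1/2^m`
  refine ⟨m, a, hma, na - n1, ?_, ?_⟩
  · unfold plusCuspDiff
    push_cast at h1 h4 ⊢
    linear_combination h1 - h4
  · have hpar : Even (na - n1) ↔ Even (na' - n1') := even_sub_iff_even_sub_of_twist h3 h6
    exact Int.not_even_iff_odd.mp fun h ↦ (Int.not_even_iff_odd.mpr hdiff_odd) (hpar.mp h)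

end GlobalToC

section Split

/-- **(★-SymbC, all levels) from the Σ-children `StarOptB` ∧ `StarGO2Sigma`** (same statement as `starSymbCAll_of_starOptB_starGO2`).
Conductor `15`: `starSymbC_of_conductorNorm_eq_fifteen`.  Off `15`: optimal model `(W₀, L₀ = q·Λ_f)` of the class, admissible data at
`N_W` (Setzer 1975, Cremona @17, Ogg–Saito @3: tree theorems), `StarOptB` ⇒ rational odd étale `2`-torsion `x₀` of `W₀`,
`star_plusOddClass` ⇒ half-lattice vector `λ` with «`2X_f(b,d)` even ⟺ loop `{0,b/d}` even at `λ/2`», `StarGO2Sigma` ⇒ admissible `β`,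
scale `g'`, twist `e` with «`Φ_β(b,d)/g'` even ⟺ (the same ⟺ `e d` even)» and an odd Eisenstein witness; hence the TWISTED global
congruence at `(½, g')`, then `depthZero_of_twistedCongruence` (`star_eisEightGlobal`) and `sameOnC_of_twistedCongruence`.
[cite: Vatsal2005, Thm. 1.1, §1.5] [cite: MazurTateTeitelbaum1986Invent, §I.10–I.13] -/
theorem starSymbCAll_of_starOptB_starGO2Sigma (hO : StarOptB) (hG : StarGO2Sigma) :
    ∀ (W : WeierstrassCurve ℚ) [W.IsElliptic] [W.IsGloballyMinimal] (x : ℚ), IsOrdinaryAt W 2 →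
      HasUniqueRationalTwoTorsionX W x →
      ((TwoTorsionRamifiedAtTwo x ∧ ¬ TwoTorsionOdd W x) ∨ (TwoTorsionOdd W x ∧ ¬ TwoTorsionRamifiedAtTwo x)) →
      ∀ ⦃N : ℕ⦄ [NeZero N] (f : CuspForm (CongruenceSubgroup.Gamma0 N) 2), IsNewformOf W f →
        ∃ β : ℕ → ℕ, IsAdmissibleStabData (W.conductorNorm ℤ) β ∧
          ∃ g g' : ℚ, g ≠ 0 ∧ g' ≠ 0 ∧
            (∀ m a, InC m a → ∃ n n' : ℤ, plusCuspDiff f m a = n * g ∧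
              stabEisCuspDiff (W.conductorNorm ℤ) β m a = n' * g' ∧ (n : ZMod 2) = (n' : ZMod 2)) ∧
            (∃ m a, InC m a ∧ ∃ n : ℤ, plusCuspDiff f m a = n * g ∧ Odd n) := by
  intro W _ _ x hord hx hAB N _ f hf
  classical
  by_cases h15 : W.conductorNorm ℤ = 15
  · exact starSymbC_of_conductorNorm_eq_fifteen W h15 f hf
  have hoddN : Odd (W.conductorNorm ℤ) :=
    Nat.odd_iff.mpr (Nat.two_dvd_ne_zero.mp (not_dvd_conductorNorm_of_hasGoodReductionAtPrime W hord.1))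
  -- admissible stabilisation data exist at `N_W` (Setzer 1975, Cremona's table at 17, Ogg–Saito at 3: tree theorems)
  have hadm : ∃ β : ℕ → ℕ, IsAdmissibleStabData (W.conductorNorm ℤ) β := by
    haveI : Fact (Nat.Prime 3) := ⟨Nat.prime_three⟩
    exact (exists_isAdmissibleStabData_conductorNorm_iff_of_isOrdinaryAt W hord).mpr
      ⟨starNoPrimeHabitat_of_setzer_of_twoTorsionList Setzer1975_primeConductor_rationalTwoTorsion_holds
          exists_smul_eq_of_conductorNorm_eq_seventeen W x hord hx hAB,
        factorization_conductorNorm_le_two_of_ne_two_of_hasRationalTwoTorsionX W 3 (by norm_num) hx.1⟩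
  -- the optimal model `(W₀, L₀, q)` of the class of `f`
  obtain ⟨D⟩ := nonempty_modularParametrizationData_of_isNewformOf hf
  have hDf : D.f = f := D.isNewformOf.unique hf
  obtain ⟨W₀, hW₀e, hW₀m, L₀, q, hf₀, hL₀, hq, hΛ₁, hΛ₂⟩ := D.exists_isGloballyMinimal_latticeEq_rat
  rw [hDf] at hf₀ hΛ₁ hΛ₂
  -- OptB: the rational odd étale point; PlusOddClass: its half-lattice vector and the plus parity; GO₂^Σ: the twisted Eisenstein parity
  obtain ⟨x₀, hx₀, hodd₀, het₀⟩ := hO W x hord hx hAB h15 f hf W₀ hf₀ L₀ hL₀ q hq hΛ₁ hΛ₂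
  obtain ⟨lam, hlam, hlam2, hxlam, hplus⟩ :=
    star_plusOddClass W W₀ f hf hf₀ L₀ hL₀ q hq hΛ₁ hΛ₂ x₀ hx₀ hodd₀
  obtain ⟨β, hβ, g', hg', e, heis, heprim⟩ :=
    hG W W₀ f hf hf₀ hord L₀ hL₀ q hq hΛ₁ hΛ₂ x₀ hx₀ het₀ lam hlam hlam2 hxlam hadm
  -- the TWISTED global congruence at the scales `(½, g')`
  have hcong : ∀ b d : ℤ, 0 < d → Int.gcd d (b * (W.conductorNorm ℤ : ℕ)) = 1 →
      ∃ n n' : ℤ, ratPlusSymbol f ((b : ℚ) / (d : ℚ)) - ratPlusSymbol f 0 = n * (1 / 2 : ℚ) ∧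
        stabEisensteinPeriod (W.conductorNorm ℤ) β (Int.gcdA d (b * (W.conductorNorm ℤ : ℕ))) b
            (-((W.conductorNorm ℤ : ℕ) : ℤ) * Int.gcdB d (b * (W.conductorNorm ℤ : ℕ))) d = n' * g' ∧
        (Even n ↔ (Even n' ↔ Even (e d))) := by
    intro b d hd hcop
    obtain ⟨n, hn, hpar⟩ := hplus b d hd hcop
    obtain ⟨n', hn', hpar'⟩ := heis b d hd hcop
    refine ⟨n, n', hn, hn', ?_⟩
    rw [hpar]
    exact iff_twist_of_iff_iff hpar'
  have hdepth := depthZero_of_twistedCongruence hoddN f hβ hcong heprim (star_eisEightGlobal _ hoddN β hβ)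
  exact ⟨β, hβ, sameOnC_of_twistedCongruence hoddN f β (by norm_num) hg' hcong hdepth⟩

end Split

/-- **E1M from the Σ-children: `StarGO2Sigma → StarOptB → DepletedLambdaLawAtTwoMod`.**  (★-SymbC, all levels) from the two
children (`starSymbCAll_of_starOptB_starGO2Sigma`); then, exactly as in `depletedLambdaLawAtTwoModOfStar_proof`, (★-EisEight)
`starEisEight₂` and (★-EisFin) `starEisFin` with the curve-side Λ-glue `star_glueFin` give (★-core), `starCongruence_of_starCore`
restores the depletion, and `depletedLambdaLawAtTwoMod_of_starCongruence` gives the crux E1M.  A candidate glue for a re-split of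
E1M into `StarGO2Sigma` ∧ `StarOptB`. [cite: GreenbergVatsal2000, §3 Thm. (3.12), display (28)]
[cite: MazurTateTeitelbaum1986Invent, §I.10–I.13] -/
theorem depletedLambdaLawAtTwoMod_of_starGO2Sigma (hG : StarGO2Sigma) (hO : StarOptB) : DepletedLambdaLawAtTwoMod :=
  depletedLambdaLawAtTwoMod_of_starCongruence
    (starCongruence_of_starCore
      (star_glueFin (starSymbCAll_of_starOptB_starGO2Sigma hO hG) starEisEight₂ starEisFin))

/-- **The untwisted child with an odd Eisenstein witness implies the twisted one** (`e := 0`): `StarGO2` as an item asks no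
primitivity of the scale `g'`, so the comparison needs the odd witness as a separate hypothesis (stated cusp-wise in the same
currency).  Recorded so that either child can serve the split. -/
theorem starGO2Sigma_of_starGO2_of_oddWitness (hG : StarGO2)
    (hodd : ∀ (W : WeierstrassCurve ℚ) [W.IsElliptic] [W.IsGloballyMinimal] (W₀ : WeierstrassCurve ℚ) [W₀.IsElliptic]
      [W₀.IsGloballyMinimal] ⦃N : ℕ⦄ [NeZero N] (f : CuspForm (CongruenceSubgroup.Gamma0 N) 2), IsNewformOf W f →
      IsNewformOf W₀ f → IsOrdinaryAt W 2 →
      ∀ (L₀ : PeriodPair), IsNeronLatticeOf (W₀.baseChange ℂ) L₀ → ∀ (q : ℚ), q ≠ 0 →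
        (∀ z ∈ periodLattice f, (q : ℂ) * z ∈ L₀.lattice) → (∀ z ∈ L₀.lattice, ∃ w ∈ periodLattice f, z = (q : ℂ) * w) →
      ∀ (x₀ : ℚ), HasRationalTwoTorsionX W₀ x₀ → ¬ TwoTorsionRamifiedAtTwo x₀ →
      ∀ (lam : ℂ), lam ∈ L₀.lattice → lam / 2 ∉ L₀.lattice →
        L₀.weierstrassP (lam / 2) - ((W₀.b₂ : ℚ) : ℂ) / 12 = ((x₀ : ℚ) : ℂ) →
      ∀ (β : ℕ → ℕ), IsAdmissibleStabData (W.conductorNorm ℤ) β → ∀ (g' : ℚ), g' ≠ 0 →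
        (∀ b d : ℤ, 0 < d → Int.gcd d (b * (W.conductorNorm ℤ : ℕ)) = 1 →
          ∃ n' : ℤ, stabEisensteinPeriod (W.conductorNorm ℤ) β (Int.gcdA d (b * (W.conductorNorm ℤ : ℕ))) b
              (-((W.conductorNorm ℤ : ℕ) : ℤ) * Int.gcdB d (b * (W.conductorNorm ℤ : ℕ))) d = n' * g' ∧
            (Even n' ↔ ∃ k : ℤ, ∃ w ∈ L₀.lattice,
              (q : ℂ) * (modularSymbol f ((b : ℚ) / (d : ℚ)) - modularSymbol f 0) = (k : ℂ) * lam + 2 * w)) →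
        ∃ b d : ℤ, 0 < d ∧ Int.gcd d (b * (W.conductorNorm ℤ : ℕ)) = 1 ∧
          ∃ n' : ℤ, stabEisensteinPeriod (W.conductorNorm ℤ) β (Int.gcdA d (b * (W.conductorNorm ℤ : ℕ))) b
              (-((W.conductorNorm ℤ : ℕ) : ℤ) * Int.gcdB d (b * (W.conductorNorm ℤ : ℕ))) d = n' * g' ∧ Odd n') :
    StarGO2Sigma := by
  intro W _ _ W₀ _ _ N _ f hf hf₀ hord L₀ hL₀ q hq hΛ₁ hΛ₂ x₀ hx₀ het₀ lam hlam hlam2 hxlam hadm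
  obtain ⟨β, hβ, g', hg', heis⟩ := hG W W₀ f hf hf₀ hord L₀ hL₀ q hq hΛ₁ hΛ₂ x₀ hx₀ het₀ lam hlam hlam2 hxlam hadm
  refine ⟨β, hβ, g', hg', fun _ ↦ 0, fun b d hd hcop ↦ ?_,
    hodd W W₀ f hf hf₀ hord L₀ hL₀ q hq hΛ₁ hΛ₂ x₀ hx₀ het₀ lam hlam hlam2 hxlam β hβ g' hg' heis⟩
  obtain ⟨n', hn', hpar'⟩ := heis b d hd hcop
  exact ⟨n', hn', by rw [hpar']; simp⟩

end DepletionAtTwo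

end Summit.BirchSwinnertonDyer.BirchSwinnertonDyer.Theorems

end
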